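import Mathlib
import Literature.NumberTheory.Sieve.Maynard2016Prop94OmegaPlus
import Literature.NumberTheory.Sieve.SelbergSieveOneDim
import Literature.NumberTheory.Sieve.FGKMT2018Prop91LamMaxError
import Literature.NumberTheory.Sieve.Maynard2016Lemma85LamBound
import HarnessLib

/-!
# Maynard (2016), Proposition 9.4 over `𝒜 = ℤ` — the error term and the eventual ranges

[cite: Maynard2016DenseClusters, Prop. 9.4 with proof pp. 25–26; FordGreenKonyaginMaynardTao2018, Thm 6 (7.14) pp. 21–22]

Bookkeeping for the final assembly of the leaf `Maynard2016DenseClusters_prop94Z`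
(`Σ_{n : L₀(n) prime > X^{1/30}} w_n ≪ (Δ_L/φ(Δ_L)) · errTermB`), with `W = wCut k B`,
`R₀ = X^{1/30}`, `M = W·B·Δ_L`:

* `discDelta_ne_zero`: `Δ_L ≠ 0` for `a₀ ≠ 0` and `L₀ ∉ 𝓛` (no parallel form);
* `two_mul_sq_lt_of_not_dvd_wCut_mul_mul`: primes `p ∤ W·B·D` satisfy `p > 2k²`;
* `cast_le_of_dvd_wCut`: primes `p ∣ W` satisfy `p ≤ 2k² ≤ R₀`;
* `mainTermA_eq_errTermB_mul_log`: `mainTermA = errTermB · log R` (`k ≥ 1`);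
* `phiOmega_cons_le_phiOmega`: `φ_{ω⁺}(W) ≤ φ_ω(W)` for the extended system `𝓛⁺ = (L₀, 𝓛)`;
* `eventually_prop94_aux`: the eventual numerical ranges used by the assembly
  (`2k² ≤ X^{1/30}`, `1 < R`, `log R ≤ (10/3) log R₀`, `X^{2/9+1/100} R₀⁴ log R ≤ X^{1−1/100}`);
* `prop94_error_frame`: in the frame of Prop. 6.1, for every `l₀` and `M`,
  `φ_{ω⁺}(W) (Σ_d |λ_d|)² (Σ_{d₀ ∈ box₀ M R₀} |λ̃_{d₀}|)² ≤ S₀(M,R₀)² · errTermB`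
  (Maynard p. 26: «the error term is trivially `O(λ_max² λ̃_max² R² R₀² W) = O(y⁴ R^{8/3})`, negligible»;
  here via `Σ|λ̃| ≤ R₀² S₀`, Lemma 8.5(i) in the form `φ_ω(W)(Σ|λ|)² ≤ X^{2/9+ε}` and `X^{1−ε} ≤ mainTermA`).
-/

namespace Literature.NumberTheory.Sieve.FGKMT2018

open Finset Real Filter

variable {k : ℕ}

/-- `Δ_L = |a₀| ∏_j |a₀b_j − a_jb₀| ≠ 0` when `a₀ ≠ 0` and `L₀` is parallel to no `L_j`.
[cite: Maynard2016DenseClusters, Prop. 6.1 statement of Δ_L p. 9; Prop. 9.4 p. 25] -/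
theorem discDelta_ne_zero {L : Fin k → ℤ × ℤ} {l₀ : ℤ × ℤ} (ha : l₀.1 ≠ 0)
    (hres : ∀ j, l₀.1 * (L j).2 - (L j).1 * l₀.2 ≠ 0) : discDelta L l₀ ≠ 0 := by
  unfold discDelta
  refine mul_ne_zero (Int.natAbs_ne_zero.2 ha) ?_
  exact Finset.prod_ne_zero_iff.2 fun j _ => Int.natAbs_ne_zero.2 (hres j)

/-- Primes not dividing `W·B·D` exceed `2k²` (all primes `≤ 2k²` divide `W·B`).
[cite: Maynard2016DenseClusters, §7 p. 13 (definition of W: every prime p ≤ 2k² divides WB)] -/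
theorem two_mul_sq_lt_of_not_dvd_wCut_mul_mul {B D p : ℕ} (hp : p.Prime)
    (h : ¬ p ∣ wCut k B * B * D) : 2 * k ^ 2 < p :=
  two_mul_sq_lt_of_not_dvd_wCut_mul hp fun h' => h (h'.mul_right D)

/-- Primes dividing `W` are `≤ 2k²`, hence `≤ R₀` as soon as `2k² ≤ R₀`.
[cite: Maynard2016DenseClusters, §7 p. 13 (W ∣ ∏_{p ≤ 2k²} p); proof of Prop. 9.4 p. 25] -/
theorem cast_le_of_dvd_wCut {B p : ℕ} {R₀ : ℝ} (hR : 2 * (k : ℝ) ^ 2 ≤ R₀) (hp : p.Prime)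
    (h : p ∣ wCut k B) : (p : ℝ) ≤ R₀ := by
  have h1 := le_two_mul_sq_of_dvd_wCut hp h
  calc (p : ℝ) ≤ ((2 * k ^ 2 : ℕ) : ℝ) := by exact_mod_cast h1
    _ = 2 * (k : ℝ) ^ 2 := by push_cast; ring
    _ ≤ R₀ := hR

/-- `mainTermA = errTermB · log R` for `k ≥ 1` (the two terms of (7.12)/(7.14) differ by one power of `log R`).
[cite: FordGreenKonyaginMaynardTao2018, (7.12)–(7.14) pp. 21–22] -/
theorem mainTermA_eq_errTermB_mul_log (hk : 1 ≤ k) (L : Fin k → ℤ × ℤ) (B : ℕ) (X R I : ℝ) :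
    mainTermA L B X R I = errTermB L B X R I * Real.log R := by
  unfold mainTermA errTermB
  obtain ⟨j, rfl⟩ : ∃ j, k = j + 1 := ⟨k - 1, by omega⟩
  simp only [Nat.add_sub_cancel, pow_succ]
  ring

/-- `φ_{ω⁺}(W) ≤ φ_ω(W)` for the extended system `𝓛⁺ = (L₀, 𝓛)` and admissible `𝓛` (since `ω⁺ ≥ ω`).
[cite: Maynard2016DenseClusters, proof of Prop. 9.4 p. 26 («φ_{ω*}(W)/W ≤ φ_ω(W)/W · ∏(1 − 1/p)»)] -/
theorem phiOmega_cons_le_phiOmega {L : Fin k → ℤ × ℤ} (hadm : FormsAdmissible L) (l₀ : ℤ × ℤ)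
    (B : ℕ) : phiOmega (Fin.cons l₀ L : Fin (k + 1) → ℤ × ℤ) (wCut k B) ≤ phiOmega L (wCut k B) := by
  refine (phiOmega_cons_le_mul_prod hadm l₀ (wCut k B)).trans ?_
  refine mul_le_of_le_one_right (phiOmega_wCut_nonneg L B) ?_
  refine Finset.prod_le_one (fun p hp => ?_) (fun p hp => ?_)
  · have hp0 : (0 : ℝ) < p := by
      exact_mod_cast (Nat.prime_of_mem_primeFactors (Finset.mem_filter.1 hp).1).pos
    have : 0 ≤ 1 / (p : ℝ) := by positivity
    have h1 : 1 / (p : ℝ) ≤ 1 := by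
      rw [div_le_one hp0]
      exact_mod_cast (Nat.prime_of_mem_primeFactors (Finset.mem_filter.1 hp).1).one_lt.le
    linarith
  · have hp0 : (0 : ℝ) < p := by
      exact_mod_cast (Nat.prime_of_mem_primeFactors (Finset.mem_filter.1 hp).1).pos
    have : 0 ≤ 1 / (p : ℝ) := by positivity
    linarith

/-- The eventual numerical ranges used by the assembly of Prop. 9.4: for `x` large, `k ≤ (log x)^{1/5}`,
`X ≥ x/2`, `X^{1/30} ≤ R ≤ X^{1/9}`: `1 ≤ X`, `1 ≤ log X`, `2k² ≤ X^{1/30}` (so every prime of `W`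
is `≤ R₀`), `1 ≤ X^{1/30}`, `1 < R`, `log R ≤ (10/3) log X^{1/30}` and the error budget
`X^{2/9+1/100} (X^{1/30})⁴ log R ≤ X^{1−1/100}`.
[cite: Maynard2016DenseClusters, proof of Prop. 9.4 pp. 25–26 (R₀ = N^{1/30}? no: threshold X^{1/30}, error «negligible»); FordGreenKonyaginMaynardTao2018, Thm 6 ranges p. 21] -/
theorem eventually_prop94_aux :
    ∀ᶠ x : ℕ in atTop, ∀ k : ℕ, (k : ℝ) ≤ Real.log x ^ ((1 : ℝ) / 5) → ∀ X R : ℝ,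
      (x : ℝ) / 2 ≤ X → X ^ ((1 : ℝ) / 30) ≤ R → R ≤ X ^ ((1 : ℝ) / 9) →
        1 ≤ X ∧ 1 ≤ Real.log X ∧ 2 * (k : ℝ) ^ 2 ≤ X ^ ((1 : ℝ) / 30) ∧ 1 ≤ X ^ ((1 : ℝ) / 30) ∧
          1 < R ∧ Real.log R ≤ 10 / 3 * Real.log (X ^ ((1 : ℝ) / 30)) ∧
          X ^ ((2 : ℝ) / 9 + 1 / 100) * (X ^ ((1 : ℝ) / 30)) ^ 4 * Real.log R ≤
            X ^ ((1 : ℝ) - 1 / 100) := by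
  have hP : Tendsto (fun x : ℕ => ((x : ℝ) / 2) ^ ((1 : ℝ) / 30)) atTop atTop :=
    (tendsto_rpow_atTop (by norm_num)).comp (tendsto_natCast_atTop_atTop.atTop_div_const (by norm_num))
  have hQ : Tendsto (fun x : ℕ => ((x : ℝ) / 2) ^ ((118 : ℝ) / 225)) atTop atTop :=
    (tendsto_rpow_atTop (by norm_num)).comp (tendsto_natCast_atTop_atTop.atTop_div_const (by norm_num))
  filter_upwards [hP.eventually_ge_atTop 2, hQ.eventually_ge_atTop 2, eventually_ge_atTop 16,
    eventually_four_pow_le_rpow (ε := (1 : ℝ) / 60) (by norm_num)]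
    with x hx2 hxQ hx16 h4 k hk X R hX hR hR9
  have hx16' : (16 : ℝ) ≤ x := by exact_mod_cast hx16
  have hx0 : (0 : ℝ) < x := by linarith
  set ℓ := Real.log (x : ℝ) with hℓ
  have hexp2 : Real.exp 2 ≤ 8 := by
    have h := Real.exp_one_lt_d9
    have : Real.exp 2 = Real.exp 1 * Real.exp 1 := by rw [← Real.exp_add]; norm_num
    rw [this]; nlinarith [Real.exp_pos 1]
  have hℓ2 : 2 ≤ ℓ := by
    rw [hℓ, Real.le_log_iff_exp_le hx0]; linarith
  have hlog2 : Real.log 2 ≤ 1 := Real.log_two_lt_d9.le.trans (by norm_num)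
  have hX1 : 1 ≤ X := by linarith
  have hX0 : 0 < X := by linarith
  have hX2 : 2 ≤ X := by linarith
  have hlogX : ℓ - Real.log 2 ≤ Real.log X := by
    rw [hℓ, ← Real.log_div hx0.ne' two_ne_zero]; exact Real.log_le_log (by positivity) hX
  have hlX1 : 1 ≤ Real.log X := by linarith
  have hlX0 : 0 < Real.log X := by linarith
  have hR₀1 : 1 ≤ X ^ ((1 : ℝ) / 30) := Real.one_le_rpow hX1 (by norm_num)
  have hR1 : 1 < R := by
    have h1 : ((x : ℝ) / 2) ^ ((1 : ℝ) / 30) ≤ X ^ ((1 : ℝ) / 30) :=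
      Real.rpow_le_rpow (by positivity) hX (by norm_num)
    linarith
  have hR0 : 0 < R := by linarith
  have hlogR : Real.log R ≤ 1 / 9 * Real.log X := by
    have h := Real.log_le_log hR0 hR9
    rwa [Real.log_rpow hX0] at h
  have hlogR0 : 0 < Real.log R := Real.log_pos hR1
  refine ⟨hX1, hlX1, ?_, hR₀1, hR1, ?_, ?_⟩
  · -- `2k² ≤ 4^{2k²} ≤ x^{1/60} ≤ (2X)^{1/60} ≤ X^{1/30}`
    have h4k := h4 k hk
    have hn : (2 * (k : ℝ) ^ 2) ≤ (4 : ℝ) ^ (2 * k ^ 2) := by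
      have h := (Nat.lt_two_pow_self (n := 2 * k ^ 2)).le
      calc (2 * (k : ℝ) ^ 2) = ((2 * k ^ 2 : ℕ) : ℝ) := by push_cast; ring
        _ ≤ ((2 ^ (2 * k ^ 2) : ℕ) : ℝ) := by exact_mod_cast h
        _ = (2 : ℝ) ^ (2 * k ^ 2) := by push_cast; ring
        _ ≤ (4 : ℝ) ^ (2 * k ^ 2) := pow_le_pow_left₀ (by norm_num) (by norm_num) _
    have hx2X : (x : ℝ) ≤ X * X := by nlinarith
    have hxX : (x : ℝ) ^ ((1 : ℝ) / 60) ≤ X ^ ((1 : ℝ) / 30) := by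
      calc (x : ℝ) ^ ((1 : ℝ) / 60) ≤ (X * X) ^ ((1 : ℝ) / 60) :=
            Real.rpow_le_rpow hx0.le hx2X (by norm_num)
        _ = X ^ ((1 : ℝ) / 30) := by
            rw [show X * X = X ^ (2 : ℕ) by ring, ← Real.rpow_natCast, ← Real.rpow_mul hX0.le]
            norm_num
    exact hn.trans (h4k.trans hxX)
  · rw [Real.log_rpow hX0]; linarith
  · -- `log R ≤ (1/9) log X ≤ (10/9) X^{1/10}`; exponents: 2/9 + 1/100 + 4/30 + 1/10 = 419/900,
    -- `10/9 ≤ 2 ≤ X^{118/225}` and `419/900 + 118/225 = 891/900 = 1 − 1/100`.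
    have hlogX' : Real.log X ≤ X ^ ((1 : ℝ) / 10) / ((1 : ℝ) / 10) :=
      Real.log_le_rpow_div hX0.le (by norm_num)
    have hR4 : (X ^ ((1 : ℝ) / 30)) ^ 4 = X ^ ((4 : ℝ) / 30) := by
      rw [← Real.rpow_natCast, ← Real.rpow_mul hX0.le]; norm_num
    have hc : (2 : ℝ) ≤ X ^ ((118 : ℝ) / 225) := by
      have h1 : ((x : ℝ) / 2) ^ ((118 : ℝ) / 225) ≤ X ^ ((118 : ℝ) / 225) :=
        Real.rpow_le_rpow (by positivity) hX (by norm_num)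
      linarith
    have hprod : X ^ ((2 : ℝ) / 9 + 1 / 100) * X ^ ((4 : ℝ) / 30) * X ^ ((1 : ℝ) / 10) *
        X ^ ((118 : ℝ) / 225) = X ^ ((1 : ℝ) - 1 / 100) := by
      rw [← Real.rpow_add hX0, ← Real.rpow_add hX0, ← Real.rpow_add hX0]; norm_num
    calc X ^ ((2 : ℝ) / 9 + 1 / 100) * (X ^ ((1 : ℝ) / 30)) ^ 4 * Real.log R
        ≤ X ^ ((2 : ℝ) / 9 + 1 / 100) * (X ^ ((1 : ℝ) / 30)) ^ 4 * (10 / 9 * X ^ ((1 : ℝ) / 10)) := by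
          apply mul_le_mul_of_nonneg_left _ (by positivity)
          linarith
      _ = 10 / 9 * (X ^ ((2 : ℝ) / 9 + 1 / 100) * X ^ ((4 : ℝ) / 30) * X ^ ((1 : ℝ) / 10)) := by
          rw [hR4]; ring
      _ ≤ X ^ ((118 : ℝ) / 225) *
            (X ^ ((2 : ℝ) / 9 + 1 / 100) * X ^ ((4 : ℝ) / 30) * X ^ ((1 : ℝ) / 10)) :=
          mul_le_mul_of_nonneg_right (by linarith) (by positivity)
      _ = X ^ ((1 : ℝ) - 1 / 100) := by rw [← hprod]; ring

/-- **The error term of Prop. 9.4 is negligible** (Maynard p. 26: «O(λ_max² λ̃_max² R² R₀² W)»):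
in the frame of Prop. 6.1, for every `l₀` and every `M`, with `R₀ = X^{1/30}`,
`φ_{ω⁺}(W) (Σ_{d ∈ 𝒟_k} |λ_d|)² (Σ_{d₀ ∈ box₀(M,R₀)} |λ̃_{d₀}|)² ≤ S₀(M,R₀)² · errTermB`;
proof: `φ_{ω⁺} ≤ φ_ω`, `Σ|λ̃| ≤ R₀² S₀` (`sum_abs_lamT_le`), `φ_ω(W)(Σ|λ|)² ≤ X^{2/9+1/100}`
(Lemma 8.5(i), `prop91_lamErr_le_rpow`) and `X^{2/9+1/100} R₀⁴ log R ≤ X^{1−1/100} ≤ mainTermA = errTermB log R`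
(`rpow_le_mainTermA_frame`).
[cite: Maynard2016DenseClusters, proof of Prop. 9.4 p. 26 (error term), Lemma 8.5(i) p. 17; FordGreenKonyaginMaynardTao2018, Thm 6 (7.14) pp. 21–22] -/
theorem prop94_error_frame :
    ∃ C : ℕ, Prop61Frame C fun B k L X R => ∀ (l₀ : ℤ × ℤ) (M : ℕ),
      phiOmega (Fin.cons l₀ L : Fin (k + 1) → ℤ × ℤ) (wCut k B) *
          ((∑ d ∈ dkBox L B R, |lamVar L B R (MaynardDense.F k) d|) ^ 2 *
            (∑ d₀ ∈ SelbergBox.box₀ M (X ^ ((1 : ℝ) / 30)),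
                |SelbergBox.lamT M (X ^ ((1 : ℝ) / 30)) d₀|) ^ 2) ≤
        SelbergBox.S0 M (X ^ ((1 : ℝ) / 30)) ^ 2 * errTermB L B X R (MaynardDense.IF k) := by
  classical
  obtain ⟨C₃, h₃⟩ := rpow_le_mainTermA_frame (ε := (1 : ℝ) / 100) (by norm_num)
  have h₁ := prop91_lamErr_le_rpow (ε := (1 : ℝ) / 100) (by norm_num)
  refine ⟨max 2 C₃, ?_⟩
  have h13 := h₁.and h₃
  unfold Prop61Frame at h13 ⊢
  filter_upwards [h13, eventually_prop94_aux] with x hx haux B hB hBx k L X R hCk hk hadm hnd hcoef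
    hX1 hX2 hR1 hR2 l₀ M
  obtain ⟨hlam, hmain⟩ := hx B hB hBx k L X R hCk hk hadm hnd hcoef hX1 hX2 hR1 hR2
  obtain ⟨hXone, hlX1, -, hR₀1, hR1', -, hbudget⟩ := haux k hk X R hX1 hR1 hR2
  have hk2 : 2 ≤ k := (le_max_left _ _).trans hCk
  have hk1 : 1 ≤ k := le_trans (by norm_num) hk2
  have hX0 : 0 < X := by linarith
  set R₀ : ℝ := X ^ ((1 : ℝ) / 30) with hR₀
  have hR₀0 : 0 ≤ R₀ := by positivity
  have hlogR : 0 < Real.log R := Real.log_pos hR1'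
  set S₀ : ℝ := SelbergBox.S0 M R₀ with hS₀
  have hS₀1 : 1 ≤ S₀ := SelbergBox.one_le_S0 hR₀1
  have hT : ∑ d₀ ∈ SelbergBox.box₀ M R₀, |SelbergBox.lamT M R₀ d₀| ≤ R₀ ^ 2 * S₀ :=
    SelbergBox.sum_abs_lamT_le hR₀0
  have hT0 : 0 ≤ ∑ d₀ ∈ SelbergBox.box₀ M R₀, |SelbergBox.lamT M R₀ d₀| :=
    Finset.sum_nonneg fun _ _ => abs_nonneg _
  set A : ℝ := (∑ d ∈ dkBox L B R, |lamVar L B R (MaynardDense.F k) d|) ^ 2 with hA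
  have hA0 : 0 ≤ A := sq_nonneg _
  have hφ : phiOmega (Fin.cons l₀ L : Fin (k + 1) → ℤ × ℤ) (wCut k B) ≤ phiOmega L (wCut k B) :=
    phiOmega_cons_le_phiOmega hadm l₀ B
  have hφ0 : 0 ≤ phiOmega L (wCut k B) := phiOmega_wCut_nonneg L B
  -- `errTermB ≥ X^{2/9+1/100} R₀⁴`
  have hE : X ^ ((2 : ℝ) / 9 + 1 / 100) * R₀ ^ 4 ≤ errTermB L B X R (MaynardDense.IF k) := by
    have h1 : X ^ ((2 : ℝ) / 9 + 1 / 100) * R₀ ^ 4 * Real.log R ≤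
        errTermB L B X R (MaynardDense.IF k) * Real.log R := by
      rw [← mainTermA_eq_errTermB_mul_log hk1]
      exact hbudget.trans hmain
    exact le_of_mul_le_mul_right h1 hlogR
  calc phiOmega (Fin.cons l₀ L : Fin (k + 1) → ℤ × ℤ) (wCut k B) *
        (A * (∑ d₀ ∈ SelbergBox.box₀ M R₀, |SelbergBox.lamT M R₀ d₀|) ^ 2)
      ≤ phiOmega L (wCut k B) * (A * (R₀ ^ 2 * S₀) ^ 2) := by
        apply mul_le_mul hφ _ (by positivity) hφ0
        exact mul_le_mul_of_nonneg_left (pow_le_pow_left₀ hT0 hT 2) hA0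
    _ = phiOmega L (wCut k B) * A * R₀ ^ 4 * S₀ ^ 2 := by ring
    _ ≤ X ^ ((2 : ℝ) / 9 + 1 / 100) * R₀ ^ 4 * S₀ ^ 2 := by
        have := hlam
        gcongr
    _ ≤ errTermB L B X R (MaynardDense.IF k) * S₀ ^ 2 :=
        mul_le_mul_of_nonneg_right hE (by positivity)
    _ = S₀ ^ 2 * errTermB L B X R (MaynardDense.IF k) := by ring

end Literature.NumberTheory.Sieve.FGKMT2018
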